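import Literature.NumberTheory.Rogawski1990.ArchTransfFamilySymmetries       -- ★ p849794 (LH7-p02 (g2)) (L2-PWC): (P) `archBzPeriodic_transfFam`, (I₄) `archBzCompactSupport_transfFam`
import Literature.NumberTheory.Rogawski1990.ArchTransfFamilyWeylDischarge    -- ★ p850030 (LH4-p01 (g2)) (W-DISCHARGE): `archBzWeyl_transfFam_of_hcWeyl`
import Literature.NumberTheory.Rogawski1990.ArchBouazizSpace                 -- ★ p849634 (LH3-p01 (g3)): the conjunction `ArchBouazizSpaceH jcH Ψ`
import Literature.NumberTheory.Rogawski1990.ArchHCOrbitalFamilyGClauses      -- ★ p849877∕ED. 4 p850054 (LH3-p02 (g2)): `archHcPeriodic_orbFamG`, `archHcWeyl_orbFamG`, `archHcCompactSupport_orbFamG`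
import HarnessLib

/-!
# (L2-ASSEMBLY) `ArchBouazizSpaceH jcH (transfFam L α μ F)` ASSEMBLED from its conjuncts: (P), (W), (I₄) are theorems, (M2) is a corollary of (I₁)+(I₂), so organ O-L2 «Transf»
# reduces to its two analytic conjuncts (SB-TRANSF) and (I₃-TRANSF) — and for the GENUINE family `orbFamG ν′ a′` with NO Harish-Chandra input on the `G′` side
# (Bouaziz 1994 §3.1–3.2 pp. 579–580, §6.2 p. 591, Rem. 2 p. 594; Shelstad 1979 §4; Rogawski 1990 §4.3 (4.3.1) p. 43)

Topic `NumberTheory/Rogawski1990`; namespace `Literature.NumberTheory.Rogawski1990`.  THEOREMS ONLY (no definition, no instance, no notation, no axiom, no named fact, no `sorry`);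
kernel lane `--kind proof --supports stmt-HodgeConjecture-24833`.  Cell `pub/hodgecm-mathlib`, crux H413 (`stmt-HodgeConjecture-24833`), F0∕P3c line LH3 (closer stub `stub_N9`,
DIRECT ROAD `F0_P3c_StubN9Direct`, organ O-L2 «Transf» = `stub_N9transf`); brick **(L2-ASSEMBLY)** (LH3-plan (g3) DEALER BOARD g3 #1 (vi), 2026-09-02T07:08:21Z); seat LH3-p02 (g2).

THE MATHEMATICS.  Organ O-L2 asserts that the candidate transfer family `transfFam L α μ F` (the `Δ″_∞`-weighted partner sum of a `G′`-side Cartan family `F`, ★ `ArchTransfFamily`)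
lies in Bouaziz's space `I^st_c(H_∞)` = ★ `ArchBouazizSpaceH jcH` = (P) ∧ (W) ∧ (I₁)+(I₂) ∧ (I₃) ∧ (I₄) whenever `F` lies in Harish-Chandra's space ★ `ArchHCSpaceG (slotSign L α) jc′`.
Three of the five conjuncts are ★ THEOREMS: (P) ★ `archBzPeriodic_transfFam` and (I₄) ★ `archBzCompactSupport_transfFam` (from `F`'s (P)∕(I₄), organ (L2-PWC)), and (W) ★
`archBzWeyl_transfFam_of_hcWeyl` (from `F`'s (W) and the continuity (M2) of `transfFam S` on `InRegS S` at the admissible labels, organ (W-DISCHARGE)).  The observation of this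
file: **(M2) is a corollary of (I₁)+(I₂)** — ★ `ArchBzSmoothBounded Ψ` says `ContDiffOn ℝ ∞ (Ψ S) (InRegS S)` on EVERY label, which is more than `ContinuousOn` — so the assembler
needs NO separate continuity hypothesis, and O-L2 is EQUIVALENT to the conjunction of its two analytic conjuncts (SB-TRANSF) `ArchBzSmoothBounded (transfFam L α μ F)` (the smooth
gluing across the `G`-walls inside `H_reg`, Rogawski Prop. 4.9.1 (a)) and (I₃-TRANSF) `ArchBzJump jcH (transfFam L α μ F)` (the jumps at the covered walls, Shelstad Thm. 4.7 (IIIb)).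
For the GENUINE family `F = orbFamG L α ν′ a′` of a compactly supported `a′` the three elementary clauses of `F` are themselves ★ theorems (★ `archHcPeriodic_orbFamG`, ★
`archHcWeyl_orbFamG`, ★ `archHcCompactSupport_orbFamG`), so there the reduction holds with NO letter on the `G′` side.

* §1 `ArchBzSmoothBounded.continuousOn` ((M2) ⊂ (I₁)+(I₂), generic `W`), `continuousOn_transfFam_of_smoothBounded`, **`archBzWeyl_transfFam_of_smoothBounded (hW : ArchHcWeyl (slotSign L α) F)
  (hSB : ArchBzSmoothBounded (transfFam L α μ F)) : ArchBzWeyl (transfFam L α μ F)`**.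
* §2 **`archBouazizSpaceH_transfFam (hP) (hW) (hI4) (hSB) (hJ) : ArchBouazizSpaceH jcH (transfFam L α μ F)`** (minimal binders: `F`'s (P), (W), (I₄) and the two analytic conjuncts of
  the transform), **`archBouazizSpaceH_transfFam_of_hc (hF : ArchHCSpaceG (slotSign L α) jc′ F) (hSB) (hJ)`** (the dealer's name), `archBouazizSpaceH_transfFam_iff (hP) (hW) (hI4) (jcH)`
  (O-L2 ⟺ (SB-TRANSF) ∧ (I₃-TRANSF)), `archBouazizSpaceH_transfFam_iff_of_hc`.
* §3 THE GENUINE FAMILY: **`archBouazizSpaceH_transfFam_orbFamG_iff (hα) (hreal) (hc′ : HasCompactSupport a′) (jcH) : ArchBouazizSpaceH jcH (transfFam L α μ (orbFamG L α ν′ a′)) ↔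
  ArchBzSmoothBounded (transfFam L α μ (orbFamG L α ν′ a′)) ∧ ArchBzJump jcH (transfFam L α μ (orbFamG L α ν′ a′))`**, `archBouazizSpaceH_transfFam_orbFamG (hSB) (hJ)`.
HONEST LABEL: HC_CM is proved only modulo the 7 printed citations (2 remaining: hLiu418 = `stmt-HodgeConjecture-24832`, h413 = `stmt-HodgeConjecture-24833`) until rung 0 closes;
count-neutral (an assembler: organ `stub_N9transf` becomes «(SB-TRANSF) ∧ (I₃-TRANSF)» by name; nothing printed is paid here).

## References
* [Bouaziz1994IntegralesOrbitales] A. Bouaziz, *Intégrales orbitales sur les groupes de Lie réductifs*, Ann. Sci. ÉNS 27 (1994) 573–609, §3.1–3.2 pp. 579–580 ((I₁)–(I₄)), §6.2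
  p. 591 (`I^st`), Rem. 2 p. 594 («Transf»).
* [Shelstad1979] D. Shelstad, *Characters and inner forms of a quasi-split group over ℝ*, Compositio Math. 39 (1979), §4 pp. 22–26, Thm. 4.7 p. 31.
* [Rogawski1990] J. D. Rogawski, *Automorphic Representations of Unitary Groups in Three Variables*, Ann. of Math. Stud. 123 (1990), §4.3 (4.3.1) p. 43, §4.9 Prop. 4.9.1 (a) p. 55,
  §14.3 pp. 233–234.
-/

set_option autoImplicit false

noncomputable section

open MeasureTheory MeasureTheory.Measure NumberField NumberField.InfinitePlace Matrix Complex Set Topology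
open scoped MatrixGroups Matrix Classical ContDiff
open Literature.NumberTheory.Automorphic Literature.NumberTheory.Automorphic.UnitaryGroup Literature.NumberTheory.Automorphic.ArchCartan
open Literature.NumberTheory.GaloisRepresentations

namespace Literature.NumberTheory.Rogawski1990

/-! ## §1 (M2) is a corollary of (I₁)+(I₂); (W) from (W) of `F` and (SB) of the transform -/

section Continuity

variable {W : Type*} [Fintype W]

/-- **(M2) ⊂ (I₁)+(I₂)**: a smooth-bounded family is continuous on Bouaziz's `T_{in-reg}` = `InRegS S` on EVERY label (`C^∞ ⇒ C⁰`). [cite: Bouaziz1994IntegralesOrbitales, §3.1 (I₁) p. 579] -/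
theorem ArchBzSmoothBounded.continuousOn {Ψ : Finset W → (W → Fin 3 → ℝ) → ℂ} (h : ArchBzSmoothBounded Ψ) (S : Finset W) : ContinuousOn (Ψ S) (InRegS S) :=
  (h S).1.continuousOn

end Continuity

section Weyl

variable (L : Type) [Field L] [NumberField L] [IsCMField L] (α : Fin 3 → L) (μ : HeckeCharacter L)
  (F : Finset {w : InfinitePlace L // IsComplex w} → ({w : InfinitePlace L // IsComplex w} → Fin 3 → ℝ) → ℂ)

/-- (M2) for the candidate transfer family, from (SB-TRANSF): `transfFam L α μ F S` is continuous on `InRegS S` for every label `S` (admissible or not).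
[cite: Bouaziz1994IntegralesOrbitales, §3.1 (I₁) p. 579] [cite: Rogawski1990, §4.9 Prop. 4.9.1 (a) p. 55] -/
theorem continuousOn_transfFam_of_smoothBounded (hSB : ArchBzSmoothBounded (transfFam L α μ F)) (S : Finset {w : InfinitePlace L // IsComplex w}) :
    ContinuousOn (transfFam L α μ F S) (InRegS S) :=
  hSB.continuousOn S

/-- **(W) of the transform from (W) of `F` and (SB) of the transform** — ★ `archBzWeyl_transfFam_of_hcWeyl` with its continuity binder fed by (I₁)+(I₂).
[cite: Shelstad1979, §4 p. 23] [cite: Bouaziz1994IntegralesOrbitales, §3.1 p. 579; §6.2 p. 591] -/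
theorem archBzWeyl_transfFam_of_smoothBounded (hW : ArchHcWeyl (slotSign L α) F) (hSB : ArchBzSmoothBounded (transfFam L α μ F)) : ArchBzWeyl (transfFam L α μ F) :=
  archBzWeyl_transfFam_of_hcWeyl L α μ F hW fun S _ => hSB.continuousOn S

end Weyl

/-! ## §2 The assembler: O-L2 ⟺ (SB-TRANSF) ∧ (I₃-TRANSF) -/

section Assembly

variable (L : Type) [Field L] [NumberField L] [IsCMField L] (α : Fin 3 → L) (μ : HeckeCharacter L)
  (F : Finset {w : InfinitePlace L // IsComplex w} → ({w : InfinitePlace L // IsComplex w} → Fin 3 → ℝ) → ℂ)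

/-- **`transfFam L α μ F ∈ I^st_c(H_∞)` ASSEMBLED, minimal binders**: (P), (W), (I₄) of the `G′`-family `F` and the two analytic conjuncts of the transform — (I₁)+(I₂) `ArchBzSmoothBounded`
and (I₃) `ArchBzJump jcH` — give `ArchBouazizSpaceH jcH (transfFam L α μ F)` ((P) ★ `archBzPeriodic_transfFam`, (W) §1, (I₄) ★ `archBzCompactSupport_transfFam`).
[cite: Bouaziz1994IntegralesOrbitales, §3.2 p. 580; §6.2 p. 591; Rem. 2 p. 594] [cite: Shelstad1979, Thm. 4.7 (p. 31)] -/
theorem archBouazizSpaceH_transfFam {jcH : Finset {w : InfinitePlace L // IsComplex w} → {w : InfinitePlace L // IsComplex w} → ℂ}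
    (hP : ArchHcPeriodic F) (hW : ArchHcWeyl (slotSign L α) F) (hI4 : ArchHcCompactSupport F)
    (hSB : ArchBzSmoothBounded (transfFam L α μ F)) (hJ : ArchBzJump jcH (transfFam L α μ F)) : ArchBouazizSpaceH jcH (transfFam L α μ F) :=
  ⟨archBzPeriodic_transfFam L α μ F hP, archBzWeyl_transfFam_of_smoothBounded L α μ F hW hSB, hSB, hJ, archBzCompactSupport_transfFam L α μ F hI4⟩

/-- **(L2-ASSEMBLY), the dealer's form**: for `F` in Harish-Chandra's space `ArchHCSpaceG (slotSign L α) jc′` (letter L1 ∕ ★ `archHCSpaceG_orbFamG` for the genuine family), the transform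
lies in `ArchBouazizSpaceH jcH` as soon as its two analytic conjuncts (SB-TRANSF) and (I₃-TRANSF) hold — organ `stub_N9transf` = «assembler ∘ (SB-TRANSF) ∘ (I₃-TRANSF)», (M2) included.
[cite: Bouaziz1994IntegralesOrbitales, §3.2 p. 580; Rem. 2 p. 594] [cite: Shelstad1979, Thm. 4.7 (p. 31)] [cite: Rogawski1990, §4.3 (4.3.1) p. 43] -/
theorem archBouazizSpaceH_transfFam_of_hc {jc' : Finset {w : InfinitePlace L // IsComplex w} → {w : InfinitePlace L // IsComplex w} → Fin 3 → Fin 3 → ℂ}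
    {jcH : Finset {w : InfinitePlace L // IsComplex w} → {w : InfinitePlace L // IsComplex w} → ℂ}
    (hF : ArchHCSpaceG (slotSign L α) jc' F) (hSB : ArchBzSmoothBounded (transfFam L α μ F)) (hJ : ArchBzJump jcH (transfFam L α μ F)) :
    ArchBouazizSpaceH jcH (transfFam L α μ F) :=
  archBouazizSpaceH_transfFam L α μ F hF.1 hF.2.1 hF.2.2.2.1 hSB hJ

/-- **O-L2 ⟺ (SB-TRANSF) ∧ (I₃-TRANSF)** given (P), (W), (I₄) of `F`. [cite: Bouaziz1994IntegralesOrbitales, §3.2 p. 580; §6.2 p. 591] -/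
theorem archBouazizSpaceH_transfFam_iff (hP : ArchHcPeriodic F) (hW : ArchHcWeyl (slotSign L α) F) (hI4 : ArchHcCompactSupport F)
    (jcH : Finset {w : InfinitePlace L // IsComplex w} → {w : InfinitePlace L // IsComplex w} → ℂ) :
    ArchBouazizSpaceH jcH (transfFam L α μ F) ↔ ArchBzSmoothBounded (transfFam L α μ F) ∧ ArchBzJump jcH (transfFam L α μ F) :=
  ⟨fun h => ⟨h.smoothBounded, h.jump⟩, fun h => archBouazizSpaceH_transfFam L α μ F hP hW hI4 h.1 h.2⟩

/-- The same equivalence for `F` in Harish-Chandra's space. [cite: Bouaziz1994IntegralesOrbitales, §3.2 p. 580; Rem. 2 p. 594] -/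
theorem archBouazizSpaceH_transfFam_iff_of_hc {jc' : Finset {w : InfinitePlace L // IsComplex w} → {w : InfinitePlace L // IsComplex w} → Fin 3 → Fin 3 → ℂ}
    (hF : ArchHCSpaceG (slotSign L α) jc' F) (jcH : Finset {w : InfinitePlace L // IsComplex w} → {w : InfinitePlace L // IsComplex w} → ℂ) :
    ArchBouazizSpaceH jcH (transfFam L α μ F) ↔ ArchBzSmoothBounded (transfFam L α μ F) ∧ ArchBzJump jcH (transfFam L α μ F) :=
  archBouazizSpaceH_transfFam_iff L α μ F hF.1 hF.2.1 hF.2.2.2.1 jcH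

end Assembly

/-! ## §3 The genuine family: no letter on the `G′` side for (P), (W), (I₄) -/

section Genuine

variable (L : Type) [Field L] [NumberField L] [IsCMField L] (α : Fin 3 → L) (μ : HeckeCharacter L)
  [MeasurableSpace (arch (maximalRealSubfield L) L (IsCMField.complexConj L) 3 (Matrix.diagonal α))]
  [BorelSpace (arch (maximalRealSubfield L) L (IsCMField.complexConj L) 3 (Matrix.diagonal α))]
  (ν' : Measure (arch (maximalRealSubfield L) L (IsCMField.complexConj L) 3 (Matrix.diagonal α))) [ν'.IsHaarMeasure] [ν'.IsMulRightInvariant]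

/-- **O-L2 FOR THE GENUINE FAMILY ⟺ (SB-TRANSF) ∧ (I₃-TRANSF), HC-FREE**: for a compactly supported `a′` on `G′_∞ = U(diag α)_∞` (non-degenerate frame with real entries at every complex place),
`transfFam L α μ (orbFamG L α ν′ a′) ∈ ArchBouazizSpaceH jcH` iff its (I₁)+(I₂) and (I₃) clauses hold — (P), (W), (I₄) of `orbFamG ν′ a′` are ★ theorems (`archHcPeriodic_orbFamG`,
`archHcWeyl_orbFamG`, `archHcCompactSupport_orbFamG`), no Harish-Chandra input. [cite: Bouaziz1994IntegralesOrbitales, §3.2 p. 580; Rem. 2 p. 594] [cite: Rogawski1990, §4.3 (4.3.1) p. 43]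
[cite: Shelstad1979, Thm. 4.7 (p. 31)] -/
theorem archBouazizSpaceH_transfFam_orbFamG_iff (hα : ∀ i, α i ≠ 0) (hreal : ∀ (w : {w : InfinitePlace L // IsComplex w}) (k : Fin 3), (w.1.embedding (α k)).im = 0)
    {a' : arch (maximalRealSubfield L) L (IsCMField.complexConj L) 3 (Matrix.diagonal α) → ℂ} (hc' : HasCompactSupport a')
    (jcH : Finset {w : InfinitePlace L // IsComplex w} → {w : InfinitePlace L // IsComplex w} → ℂ) :
    ArchBouazizSpaceH jcH (transfFam L α μ (orbFamG L α ν' a')) ↔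
      ArchBzSmoothBounded (transfFam L α μ (orbFamG L α ν' a')) ∧ ArchBzJump jcH (transfFam L α μ (orbFamG L α ν' a')) :=
  archBouazizSpaceH_transfFam_iff L α μ (orbFamG L α ν' a') (archHcPeriodic_orbFamG L α ν' a') (archHcWeyl_orbFamG L α ν' hα hreal a')
    (archHcCompactSupport_orbFamG L α ν' hc') jcH

/-- The genuine family's transform is in `I^st_c(H_∞)` from its two analytic conjuncts. [cite: Bouaziz1994IntegralesOrbitales, §3.2 p. 580; Rem. 2 p. 594] [cite: Rogawski1990, §4.3 (4.3.1) p. 43] -/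
theorem archBouazizSpaceH_transfFam_orbFamG (hα : ∀ i, α i ≠ 0) (hreal : ∀ (w : {w : InfinitePlace L // IsComplex w}) (k : Fin 3), (w.1.embedding (α k)).im = 0)
    {a' : arch (maximalRealSubfield L) L (IsCMField.complexConj L) 3 (Matrix.diagonal α) → ℂ} (hc' : HasCompactSupport a')
    {jcH : Finset {w : InfinitePlace L // IsComplex w} → {w : InfinitePlace L // IsComplex w} → ℂ}
    (hSB : ArchBzSmoothBounded (transfFam L α μ (orbFamG L α ν' a'))) (hJ : ArchBzJump jcH (transfFam L α μ (orbFamG L α ν' a'))) :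
    ArchBouazizSpaceH jcH (transfFam L α μ (orbFamG L α ν' a')) :=
  (archBouazizSpaceH_transfFam_orbFamG_iff L α μ ν' hα hreal hc' jcH).2 ⟨hSB, hJ⟩

end Genuine

end Literature.NumberTheory.Rogawski1990

end
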